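import Mathlib
import Literature.Probability.LatticeModels.TransferOperator

/-!
# Thermal smallness from a transfer-matrix gap
(crux `QuarksAsStableAction.StableActionBridge`, item stmt-QuantumFields-9737, line `Sketch`;
registered stubs `thermal_smallness_le_gapNorm_pow`, `thermal_smallness_le_of_hasMassGap`,
`thermal_smallness_le_half` of the lead skeleton)

For transfer data `(T, Ω)` on a finite-dimensional complex Hilbert space `H` (a positive
contraction `T` with `T Ω = Ω`, `‖Ω‖ = 1`) the lattice functional on a time-periodic torus of
extent `L` is a twisted trace normalised by `Tr T^L`, and every transfer lemma of the line carries
the *thermal smallness*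

  `ε_L := Re Tr T^L - 1`,

the trace of `T^L` over the orthogonal complement of the vacuum line. We discharge it from a
transfer-matrix gap:

* `thermal_smallness_le_gapNorm_pow`: `ε_L ≤ (dim H - 1) · gapNorm^L`;
* `thermal_smallness_le_of_hasMassGap`: under a mass gap `gapNorm ≤ e^{-m}`,
  `ε_L ≤ (dim H - 1) · e^{-m L}`;
* `thermal_smallness_le_half`: hence `ε_L ≤ 1/2` as soon as `m L ≥ log (2 (dim H - 1))`.

Proof of the first: with `P` the orthogonal projection onto the vacuum line and `Q = 1 - P`,
`Tr (T^L P) = ⟪Ω, T^L Ω⟫ = 1`, so `ε_L = Re Tr (Q T^L Q)` (the powers of `T` preserve `Ω^⊥`);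
expanding the trace in an orthonormal basis `b` of `H`,
`Re ⟪Q bᵢ, T^L Q bᵢ⟫ ≤ ‖Q bᵢ‖ ‖T^L Q bᵢ‖ ≤ gapNorm^L ‖Q bᵢ‖²` (on `Ω^⊥` each power of `T`
contracts by `gapNorm`), and `∑ᵢ ‖Q bᵢ‖² = Tr Q = Tr 1 - Tr P = dim H - 1`.
-/

namespace Summit.QuantumFields.QCD.Cruxes.StableActionBridge.Sketch

open scoped InnerProductSpace ComplexOrder
open Literature.Probability.LatticeModels

/-- **Thermal smallness from the gap norm.** For transfer data `(T, Ω)` on a finite-dimensional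
complex Hilbert space `H` and every Euclidean time extent `L`,
`Re Tr T^L - 1 ≤ (dim H - 1) · ‖T P_{Ω^⊥}‖^L`: the trace of `T^L` over `Ω^⊥` is a sum of
`dim H - 1` diagonal matrix elements, each bounded by `gapNorm^L`. [folklore] -/
theorem thermal_smallness_le_gapNorm_pow : ∀ (H : Type) [NormedAddCommGroup H] [InnerProductSpace ℂ H] [CompleteSpace H] [FiniteDimensional ℂ H] (D : TransferData H) (L : ℕ), (LinearMap.trace ℂ H ((D.T ^ L : H →L[ℂ] H) : H →ₗ[ℂ] H)).re - 1 ≤ ((Module.finrank ℂ H : ℝ) - 1) * D.gapNorm ^ L := by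
  intro H _ _ _ _ D L
  -- the two complementary orthogonal projections and the compressed transfer power
  set P : H →L[ℂ] H := (D.vacuumLine).starProjection with hPdef
  set Q : H →L[ℂ] H := (D.vacuumLine)ᗮ.starProjection with hQdef
  set M : H →L[ℂ] H := Q * D.T ^ L * Q with hMdef
  have hPQ : P + Q = 1 := by
    rw [ContinuousLinearMap.one_def]
    exact (Submodule.id_eq_sum_starProjection_self_orthogonalComplement (K := D.vacuumLine)).symm
  have hP : P = InnerProductSpace.rankOne ℂ D.vacuum D.vacuum := by
    ext w
    rw [hPdef, TransferData.vacuumLine,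
      Submodule.starProjection_unit_singleton ℂ D.norm_vacuum, InnerProductSpace.rankOne_apply]
  -- trace against the vacuum projection is the vacuum expectation
  have htrP : ∀ A : H →L[ℂ] H,
      LinearMap.trace ℂ H ((A * P : H →L[ℂ] H) : H →ₗ[ℂ] H) = ⟪D.vacuum, A D.vacuum⟫_ℂ := by
    intro A
    rw [hP, ContinuousLinearMap.mul_def, InnerProductSpace.comp_rankOne,
      InnerProductSpace.trace_rankOne]
  -- the powers of `T` preserve `Ω^⊥`, so `T^L Q = Q T^L Q`
  have hTQ : D.T ^ L * Q = M := by
    ext w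
    rw [hMdef]
    simp only [mul_apply_eq_comp]
    exact (Submodule.starProjection_eq_self_iff.mpr
      (D.pow_apply_mem_orthogonal_and_norm_le (Submodule.starProjection_apply_mem _ w) L).1).symm
  -- `Re Tr T^L - 1 = Re Tr M`
  have hT : (LinearMap.trace ℂ H ((D.T ^ L : H →L[ℂ] H) : H →ₗ[ℂ] H)).re - 1 =
      (LinearMap.trace ℂ H (M : H →ₗ[ℂ] H)).re := by
    have hsplit : D.T ^ L = D.T ^ L * P + M := by
      calc D.T ^ L = D.T ^ L * (P + Q) := by rw [hPQ, mul_one]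
        _ = D.T ^ L * P + M := by rw [mul_add, hTQ]
    rw [hsplit, ContinuousLinearMap.toLinearMap_add, map_add, htrP, D.pow_apply_vacuum,
      inner_self_eq_one_of_norm_eq_one D.norm_vacuum, Complex.add_re, Complex.one_re]
    ring
  -- an orthonormal basis of `H` and `∑ᵢ ‖Q bᵢ‖² = Tr Q = dim H - 1`
  obtain ⟨b⟩ : Nonempty (OrthonormalBasis (Fin (Module.finrank ℂ H)) ℂ H) :=
    ⟨stdOrthonormalBasis ℂ H⟩
  have hQfix : ∀ v : H, Q (Q v) = Q v := fun v =>
    Submodule.starProjection_eq_self_iff.mpr (Submodule.starProjection_apply_mem _ v)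
  have hQsum : ∑ i, ‖Q (b i)‖ ^ 2 = (Module.finrank ℂ H : ℝ) - 1 := by
    have h1 : LinearMap.trace ℂ H (Q : H →ₗ[ℂ] H) = (Module.finrank ℂ H : ℂ) - 1 := by
      rw [eq_sub_of_add_eq' hPQ, ContinuousLinearMap.toLinearMap_sub, map_sub,
        ContinuousLinearMap.toLinearMap_one, LinearMap.trace_one, ← one_mul P, htrP,
        one_apply_eq_self, inner_self_eq_one_of_norm_eq_one D.norm_vacuum]
    have h2 : LinearMap.trace ℂ H (Q : H →ₗ[ℂ] H) = ∑ i, ((‖Q (b i)‖ ^ 2 : ℝ) : ℂ) := by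
      rw [LinearMap.trace_eq_sum_inner _ b]
      refine Finset.sum_congr rfl fun i _ => ?_
      have hsa : ⟪b i, Q (b i)⟫_ℂ = ⟪Q (b i), Q (b i)⟫_ℂ := by
        calc ⟪b i, Q (b i)⟫_ℂ = ⟪b i, Q (Q (b i))⟫_ℂ := by rw [hQfix]
          _ = ⟪Q (b i), Q (b i)⟫_ℂ := (Submodule.inner_starProjection_left_eq_right _ _ _).symm
      rw [ContinuousLinearMap.coe_coe, hsa, inner_self_eq_norm_sq_to_K]
      norm_cast
    have h12 := h2.symm.trans h1
    exact_mod_cast h12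
  -- `Re Tr M ≤ gapNorm^L · ∑ᵢ ‖Q bᵢ‖²`
  have hM : (LinearMap.trace ℂ H (M : H →ₗ[ℂ] H)).re ≤ D.gapNorm ^ L * ∑ i, ‖Q (b i)‖ ^ 2 := by
    rw [LinearMap.trace_eq_sum_inner _ b, Complex.re_sum, Finset.mul_sum]
    refine Finset.sum_le_sum fun i _ => ?_
    obtain ⟨-, hnorm⟩ :=
      D.pow_apply_mem_orthogonal_and_norm_le (Submodule.starProjection_apply_mem _ (b i)) L
    have hinner : ⟪b i, M (b i)⟫_ℂ = ⟪Q (b i), (D.T ^ L) (Q (b i))⟫_ℂ := by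
      rw [hMdef]
      simp only [mul_apply_eq_comp]
      exact (Submodule.inner_starProjection_left_eq_right _ _ _).symm
    rw [ContinuousLinearMap.coe_coe, hinner]
    calc (⟪Q (b i), (D.T ^ L) (Q (b i))⟫_ℂ).re ≤ ‖⟪Q (b i), (D.T ^ L) (Q (b i))⟫_ℂ‖ :=
          Complex.re_le_norm _
      _ ≤ ‖Q (b i)‖ * ‖(D.T ^ L) (Q (b i))‖ := norm_inner_le_norm _ _
      _ ≤ ‖Q (b i)‖ * (D.gapNorm ^ L * ‖Q (b i)‖) :=
          mul_le_mul_of_nonneg_left hnorm (norm_nonneg _)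
      _ = D.gapNorm ^ L * ‖Q (b i)‖ ^ 2 := by ring
  rw [hT]
  calc (LinearMap.trace ℂ H (M : H →ₗ[ℂ] H)).re ≤ D.gapNorm ^ L * ∑ i, ‖Q (b i)‖ ^ 2 := hM
    _ = ((Module.finrank ℂ H : ℝ) - 1) * D.gapNorm ^ L := by rw [hQsum, mul_comm]

/-- **Thermal smallness under a mass gap.** If the transfer data has a mass gap `≥ m`
(`‖T P_{Ω^⊥}‖ ≤ e^{-m}`), then `Re Tr T^L - 1 ≤ (dim H - 1) · e^{-m L}` for every time
extent `L`. [folklore] -/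
theorem thermal_smallness_le_of_hasMassGap : ∀ (H : Type) [NormedAddCommGroup H] [InnerProductSpace ℂ H] [CompleteSpace H] [FiniteDimensional ℂ H] (D : TransferData H) (m : ℝ) (L : ℕ), D.HasMassGap m → (LinearMap.trace ℂ H ((D.T ^ L : H →L[ℂ] H) : H →ₗ[ℂ] H)).re - 1 ≤ ((Module.finrank ℂ H : ℝ) - 1) * Real.exp (-(m * L)) := by
  intro H _ _ _ _ D m L hm
  have hexp : D.gapNorm ^ L ≤ Real.exp (-(m * L)) := by
    calc D.gapNorm ^ L ≤ Real.exp (-m) ^ L := pow_le_pow_left₀ D.gapNorm_nonneg hm.2 L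
      _ = Real.exp (-(m * L)) := by rw [← Real.exp_nat_mul]; congr 1; ring
  have hvac : D.vacuum ≠ 0 := by
    intro h0
    have h1 := D.norm_vacuum
    rw [h0, norm_zero] at h1
    exact zero_ne_one h1
  have hd : (1 : ℝ) ≤ (Module.finrank ℂ H : ℝ) := by
    have h : 0 < Module.finrank ℂ H :=
      Module.finrank_pos_iff_exists_ne_zero.mpr ⟨D.vacuum, hvac⟩
    exact_mod_cast h
  exact (thermal_smallness_le_gapNorm_pow H D L).trans
    (mul_le_mul_of_nonneg_left hexp (by linarith))

/-- **Thermal smallness is at most `1/2` for long time extents.** If the transfer data has a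
mass gap `≥ m` and `m L ≥ log (2 (dim H - 1))`, then `Re Tr T^L - 1 ≤ 1/2`; this is the
hypothesis `ε ≤ 1/2` of the twisted Goldstone chain. [folklore] -/
theorem thermal_smallness_le_half : ∀ (H : Type) [NormedAddCommGroup H] [InnerProductSpace ℂ H] [CompleteSpace H] [FiniteDimensional ℂ H] (D : TransferData H) (m : ℝ) (L : ℕ), D.HasMassGap m → Real.log (2 * ((Module.finrank ℂ H : ℝ) - 1)) ≤ m * L → (LinearMap.trace ℂ H ((D.T ^ L : H →L[ℂ] H) : H →ₗ[ℂ] H)).re - 1 ≤ 1 / 2 := by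
  intro H _ _ _ _ D m L hm hL
  refine (thermal_smallness_le_of_hasMassGap H D m L hm).trans ?_
  rcases le_or_gt ((Module.finrank ℂ H : ℝ) - 1) 0 with hd | hd
  · -- `dim H = 1`: the bound is nonpositive
    have h := mul_le_mul_of_nonneg_right hd (Real.exp_nonneg (-(m * L)))
    rw [zero_mul] at h
    linarith
  · -- `dim H ≥ 2`: `2 (dim H - 1) = e^{log (2 (dim H - 1))} ≤ e^{m L}`
    have h2 : 2 * ((Module.finrank ℂ H : ℝ) - 1) ≤ Real.exp (m * L) := by
      have h := Real.exp_le_exp.mpr hL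
      rwa [Real.exp_log (by linarith)] at h
    calc ((Module.finrank ℂ H : ℝ) - 1) * Real.exp (-(m * L))
        = 2 * ((Module.finrank ℂ H : ℝ) - 1) * Real.exp (-(m * L)) / 2 := by ring
      _ ≤ Real.exp (m * L) * Real.exp (-(m * L)) / 2 := by gcongr
      _ = 1 / 2 := by rw [← Real.exp_add, add_neg_cancel, Real.exp_zero]

end Summit.QuantumFields.QCD.Cruxes.StableActionBridge.Sketch
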